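import Literature.AlgebraicGeometry.Motives.ProjectiveLineInvolution
import HarnessLib

/-!
# The rational points `0 = (1 : 0)` and `∞ = (0 : 1)` of `ℙ¹` and their uniformisers

Fulton, *Intersection Theory*, Example 1.5.1 and Prop. 1.6 use that on `ℙ¹ = Proj k[x₀, x₁]`
the coordinate `t = x₁/x₀` has `div(t) = [0] - [∞]` with `0 = (1 : 0)`, `∞ = (0 : 1)`: `t` is a
uniformiser of the discrete valuation ring `𝒪_{ℙ¹,0}`, `t⁻¹ = x₀/x₁` one of `𝒪_{ℙ¹,∞}`, and `t` is
a unit at every other point. This file proves exactly these three facts for the projective line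
`ProjLine.P k` of `Motives/ProjectiveLineInvolution`, uniformly in the chart index `i : Fin 2`
(the point `ptᵢ` of the chart `D₊(xᵢ) ≅ Spec k[T]` where `T = x_j/x_i` vanishes):

* `ProjLine.pt i : AlgPoints (Pover k) k` — the rational points `(1 : 0)` (`i = 0`) and `(0 : 1)`
  (`i = 1`), as `k`-morphisms `Spec k → ℙ¹` through the charts (`ProjLine.ptHom`);
* `ProjLine.primeIdealOf_y` — in the affine chart `D₊(xᵢ)` the prime ideal of `ptᵢ` is generated
  by the section `x_j/x_i` (its pull-back to `Spec k` is `T(0) = 0`, and `k[T] → k` has kernel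
  `(T)`);
* `ProjLine.exists_uniformiser` — `𝔪_{ℙ¹, ptᵢ}` is generated by an element mapping to `x_j/x_i`
  in `K(ℙ¹)`, i.e. to `t` at `0` and to `t⁻¹` at `∞` (the stalk is the localisation of the chart
  ring at that prime, Mathlib `IsAffineOpen.isLocalization_stalk`);
* `ProjLine.exists_isUnit_of_ne` — at every point other than `0, ∞`, `t` is the image of a unit
  of the local ring; `ProjLine.y_zero_ne_y_one` — `0 ≠ ∞`.

## References

* [Fulton1998] W. Fulton, *Intersection Theory*, 2nd ed. (1998), Example 1.5.1, §1.6, Prop. 1.6.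
* [Hartshorne1977] R. Hartshorne, *Algebraic Geometry* (1977), II Prop. 2.5 (b), II Prop. 6.5 ff.
  (`ℙ¹`, `K(ℙ¹) = k(t)`).
-/

open CategoryTheory AlgebraicGeometry HomogeneousLocalization MvPolynomial Limits IsLocalRing
  TopologicalSpace
open Literature.AlgebraicGeometry.Motives

universe u

noncomputable section

attribute [local instance] MvPolynomial.gradedAlgebra MvPolynomial.algebraMvPolynomial
  Literature.AlgebraicGeometry.Motives.ProjBaseChange.algebraBase

namespace Literature.AlgebraicGeometry.Motives.ProjLine

variable (k : Type u) [Field k]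

/-! ### The charts `D₊(xᵢ)`, the sections `x_j/x_i`, and the points where they vanish -/

/-- The other index: `j = i.succAbove 0`, so `(i, j) = (0, 1)` or `(1, 0)`. [folklore] -/
abbrev other (i : Fin 2) : Fin 2 := i.succAbove 0

/-- The generic point lies in every chart `D₊(xᵢ)` (instance form, so that
`Scheme.germToFunctionField (D₊(xᵢ))` is available). [folklore] -/
instance nonempty_basicOpen_X (i : Fin 2) : Nonempty (Proj.basicOpen (A k) (X i)) :=
  ⟨⟨_, genericPoint_mem_basicOpen_X k i⟩⟩

/-- The section `x_j/x_i ∈ Γ(ℙ¹, D₊(xᵢ))`. [folklore] -/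
def sec (i : Fin 2) : Γ(P k, Proj.basicOpen (A k) (X i)) :=
  Proj.awayToSection (A k) (X i) (e k (X i) (X (other i)) (Segre.X_mem k i) (Segre.X_mem k _))

/-- The rational function `τᵢ = x_j/x_i ∈ K(ℙ¹)` (`τ₀ = t`, `τ₁ = t⁻¹`). [folklore] -/
def τ (i : Fin 2) : (P k).functionField :=
  T k (X i) (X (other i)) (Segre.X_mem k i) (Segre.X_mem k _) (genericPoint_mem_basicOpen_X k i)

/-- `τᵢ` is the germ of the section `x_j/x_i` at the generic point. [folklore] -/
theorem germToFunctionField_sec (i : Fin 2) :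
    (P k).germToFunctionField (Proj.basicOpen (A k) (X i)) (sec k i) = τ k i :=
  rfl

/-- `τ₀ = t`. [folklore] -/
theorem τ_zero : τ k 0 = t k := rfl

/-- `τ₁ = t⁻¹`. [folklore] -/
theorem τ_one : τ k 1 = (t k)⁻¹ :=
  eq_inv_of_mul_eq_one_right (t_mul k)

/-- `τᵢ ≠ 0`. [folklore] -/
theorem τ_ne_zero (i : Fin 2) : τ k i ≠ 0 := by
  fin_cases i
  · exact t_ne_zero k
  · change τ k 1 ≠ 0
    rw [τ_one]; exact inv_ne_zero (t_ne_zero k)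

/-- `D₊(xᵢ)` is an affine open of `ℙ¹` (it is `Spec (k[x]_{(xᵢ)})₀`). [folklore] -/
theorem isAffineOpen_basicOpen_X (i : Fin 2) : IsAffineOpen (Proj.basicOpen (A k) (X i)) := by
  rw [← Proj.opensRange_awayι (A k) (X i) (Segre.X_mem k i) zero_lt_one]
  exact isAffineOpen_opensRange _

/-- `x_j/x_i` is the chart generator of `Motives/VarietiesProjectiveSpaceProofs`. [folklore] -/
theorem e_eq_chartGen' (i : Fin 2) :
    e k (X i) (X (other i)) (Segre.X_mem k i) (Segre.X_mem k _) =
      ProjectiveSpace.chartGen k (n := 1) i 0 := by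
  apply HomogeneousLocalization.val_injective
  rw [e, Away.val_mk, ProjectiveSpace.val_chartGen]

/-- The chart isomorphism `(k[x₀,x₁]_{(xᵢ)})₀ ≃ₐ[k] k[T]`, `x_j/x_i ↦ T`. [folklore] -/
def ψ' (i : Fin 2) : Away (A k) (X i) ≃ₐ[k] Polynomial k :=
  (ProjectiveSpace.chartAlgEquiv k (n := 1) i).trans (MvPolynomial.uniqueAlgEquiv k (Fin 1))

/-- `ψ' (x_j/x_i) = T`. [folklore] -/
theorem ψ'_e (i : Fin 2) :
    ψ' k i (e k (X i) (X (other i)) (Segre.X_mem k i) (Segre.X_mem k _)) = Polynomial.X := by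
  rw [e_eq_chartGen', ψ', AlgEquiv.trans_apply, ← ProjectiveSpace.chartAlgEquiv_symm_X,
    AlgEquiv.apply_symm_apply]
  simp [MvPolynomial.uniqueAlgEquiv]

/-- Evaluation `(k[x₀,x₁]_{(xᵢ)})₀ → k` at the point where `x_j/x_i = 0`. [folklore] -/
def ev (i : Fin 2) : Away (A k) (X i) →ₐ[k] k :=
  (Polynomial.aeval (0 : k)).comp (ψ' k i).toAlgHom

/-- Unfolding `ev`. [folklore] -/
theorem ev_apply (i : Fin 2) (b : Away (A k) (X i)) : ev k i b = (ψ' k i b).eval 0 := by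
  simp [ev, Polynomial.coe_aeval_eq_eval]

/-- `ev (x_j/x_i) = 0`. [folklore] -/
theorem ev_e (i : Fin 2) :
    ev k i (e k (X i) (X (other i)) (Segre.X_mem k i) (Segre.X_mem k _)) = 0 := by
  rw [ev_apply, ψ'_e, Polynomial.eval_X]

/-- The kernel of `ev` is generated by `x_j/x_i` (`k[T] → k`, `T ↦ 0`, has kernel `(T)`).
[folklore] -/
theorem mem_span_e_of_ev_eq_zero (i : Fin 2) {b : Away (A k) (X i)} (hb : ev k i b = 0) :
    b ∈ Ideal.span {e k (X i) (X (other i)) (Segre.X_mem k i) (Segre.X_mem k _)} := by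
  rw [ev_apply, ← Polynomial.coeff_zero_eq_eval_zero, ← Polynomial.X_dvd_iff] at hb
  obtain ⟨q, hq⟩ := hb
  rw [Ideal.mem_span_singleton]
  refine ⟨(ψ' k i).symm q, ?_⟩
  apply (ψ' k i).injective
  rw [map_mul, ψ'_e, AlgEquiv.apply_symm_apply]
  exact hq

/-- `ev` restricted to the constants is the identity. [folklore] -/
theorem ev_comp_cst (i : Fin 2) : (ev k i).toRingHom.comp (Segre.cst k (X i)) = RingHom.id k := by
  ext c
  change ev k i (algebraMap k (Away (A k) (X i)) c) = c
  rw [AlgHom.commutes]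
  rfl

/-- The morphism `Spec k → ℙ¹` of the rational point `ptᵢ`: through the chart `D₊(xᵢ)` at the
prime where `x_j/x_i` vanishes. [folklore] -/
abbrev ptHom (i : Fin 2) : Spec (.of k) ⟶ P k :=
  Spec.map (CommRingCat.ofHom (ev k i).toRingHom) ≫ Segre.chartι k i

/-- `ptHom` is a morphism over `k`. [folklore] -/
theorem ptHom_toSpec (i : Fin 2) :
    ptHom k i ≫ Segre.toSpec (Fin 2) k = Spec.map (CommRingCat.ofHom (algebraMap k k)) := by
  rw [Category.assoc, Segre.chartι_toSpec, ← Spec.map_comp, ← CommRingCat.ofHom_comp, ev_comp_cst]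

/-- `ℙ¹` over `k`, as an object of `SchemeOver k`. [folklore] -/
abbrev Pover : SchemeOver k := Over.mk (Segre.toSpec (Fin 2) k)

/-- The rational point `ptᵢ ∈ ℙ¹(k)` of the chart `D₊(xᵢ)` where `x_j/x_i` vanishes: `(1 : 0)` for
`i = 0` and `(0 : 1)` for `i = 1`. [folklore] -/
def pt (i : Fin 2) : AlgPoints (Pover k) k :=
  AlgPoints.mk (X := Pover k) (ptHom k i) (ptHom_toSpec k i)

/-- The underlying morphism of `ptᵢ` is `ptHom` (by `rfl`). [folklore] -/
theorem pt_toSpecHom (i : Fin 2) : (pt k i).toSpecHom = ptHom k i := rfl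

/-- The underlying point `yᵢ ∈ ℙ¹` of `ptᵢ`. [folklore] -/
def y (i : Fin 2) : P k := (ptHom k i).base (closedPoint k)

/-- The point of `ptᵢ` is `yᵢ` (by `rfl`). [folklore] -/
theorem pt_toSpecHom_base (i : Fin 2) : (pt k i).toSpecHom.base (closedPoint k) = y k i := rfl

/-- `ptᵢ` lands in `D₊(xᵢ)`. [folklore] -/
theorem preimage_ptHom_basicOpen (i : Fin 2) : ptHom k i ⁻¹ᵁ Proj.basicOpen (A k) (X i) = ⊤ := by
  rw [Scheme.Hom.comp_preimage,
    ← Proj.opensRange_awayι (A k) (X i) (Segre.X_mem k i) zero_lt_one,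
    Scheme.Hom.preimage_opensRange]
  rfl

/-- `yᵢ ∈ D₊(xᵢ)`. [folklore] -/
theorem y_mem (i : Fin 2) : y k i ∈ Proj.basicOpen (A k) (X i) := by
  change closedPoint k ∈ ptHom k i ⁻¹ᵁ Proj.basicOpen (A k) (X i)
  rw [preimage_ptHom_basicOpen]; trivial

/-- `Spec k → ℙ¹` lands in `D₊(xᵢ)` (inequality form). [folklore] -/
theorem top_le_preimage_ptHom (i : Fin 2) :
    (⊤ : (Spec (CommRingCat.of k)).Opens) ≤ ptHom k i ⁻¹ᵁ Proj.basicOpen (A k) (X i) := by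
  rw [preimage_ptHom_basicOpen]

open GeneratingSections in
/-- Pulling the section of `b ∈ (k[x]_{(xᵢ)})₀` over `D₊(xᵢ)` back to `Spec k` along `ptᵢ` gives
the constant `ev b`. [folklore] -/
theorem res_ptHom_awayToSection (i : Fin 2) (b : Away (A k) (X i)) :
    res (ptHom k i) (Proj.basicOpen (A k) (X i)) (top_le_preimage_ptHom k i)
        (Proj.awayToSection (A k) (X i) b) =
      (Scheme.ΓSpecIso (.of k)).inv (ev k i b) := by
  have hj : ⊤ ≤ Segre.chartι k i ⁻¹ᵁ Proj.basicOpen (A k) (X i) := by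
    rw [← Proj.opensRange_awayι (A k) (X i) (Segre.X_mem k i) zero_lt_one]
    exact (Scheme.Hom.preimage_opensRange _).ge
  rw [res_comp _ _ hj, RingHom.comp_apply]
  erw [res_awayι_awayToSection (A k) (X i) (Segre.X_mem k i) zero_lt_one hj b]
  rw [← CategoryTheory.ConcreteCategory.comp_apply, ← Scheme.ΓSpecIso_inv_naturality]
  rfl

/-- `awayToSection : (k[x]_{(xᵢ)})₀ → Γ(ℙ¹, D₊(xᵢ))` is onto (an isomorphism, Mathlib
`Proj.basicOpenIsoAway`). [folklore] -/
theorem awayToSection_surjective (i : Fin 2) :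
    Function.Surjective (Proj.awayToSection (A k) (X i)) := by
  rw [← Proj.basicOpenIsoAway_hom (A k) (X i) (Segre.X_mem k i) zero_lt_one]
  exact (Proj.basicOpenIsoAway (A k) (X i) (Segre.X_mem k i)
    zero_lt_one).commRingCatIsoToRingEquiv.surjective

/-- Evaluation `s ↦ s(ptᵢ)` of sections over `D₊(xᵢ)` at the rational point `ptᵢ`:
`Γ(ℙ¹, D₊(xᵢ)) → Γ(Spec k, 𝒪) ≅ k`. [folklore] -/
def evalPt (i : Fin 2) : Γ(P k, Proj.basicOpen (A k) (X i)) →+* k :=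
  (Scheme.ΓSpecIso (.of k)).hom.hom.comp
    ((ptHom k i).appLE (Proj.basicOpen (A k) (X i)) ⊤ (top_le_preimage_ptHom k i)).hom

/-- `(x_j/x_i · b)(ptᵢ) = ev b`: evaluating the section of `b` at `ptᵢ`. [folklore] -/
theorem evalPt_awayToSection (i : Fin 2) (b : Away (A k) (X i)) :
    evalPt k i (Proj.awayToSection (A k) (X i) b) = ev k i b := by
  have h := res_ptHom_awayToSection k i b
  rw [GeneratingSections.res] at h
  change (Scheme.ΓSpecIso (.of k)).hom (((ptHom k i).appLE (Proj.basicOpen (A k) (X i)) ⊤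
    (top_le_preimage_ptHom k i)).hom (Proj.awayToSection (A k) (X i) b)) = _
  rw [h, CategoryTheory.Iso.inv_hom_id_apply]

/-- `evalPt (x_j/x_i) = 0`. [folklore] -/
theorem evalPt_sec (i : Fin 2) : evalPt k i (sec k i) = 0 := by
  rw [sec, evalPt_awayToSection, ev_e]

/-- Evaluation at `ptᵢ` is onto `k` (constants). [folklore] -/
theorem evalPt_surjective (i : Fin 2) : Function.Surjective (evalPt k i) := by
  intro c
  refine ⟨Proj.awayToSection (A k) (X i) (Segre.cst k (X i) c), ?_⟩
  rw [evalPt_awayToSection]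
  exact congrFun (congrArg DFunLike.coe (ev_comp_cst k i)) c

/-- The prime ideal of `yᵢ` in the affine chart `D₊(xᵢ)` is the kernel of the evaluation at `ptᵢ`
(the prime of the point of `Spec k` being `⊥`; Mathlib `IsAffineOpen.comap_primeIdealOf_appLE`).
[folklore] -/
theorem mem_primeIdealOf_y_iff (i : Fin 2) (s : Γ(P k, Proj.basicOpen (A k) (X i))) :
    s ∈ ((isAffineOpen_basicOpen_X k i).primeIdealOf ⟨y k i, y_mem k i⟩).asIdeal ↔
      evalPt k i s = 0 := by
  have key := IsAffineOpen.comap_primeIdealOf_appLE (f := ptHom k i)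
    (x := closedPoint k) (Proj.basicOpen (A k) (X i)) (isAffineOpen_basicOpen_X k i) ⊤
    (isAffineOpen_top _) (top_le_preimage_ptHom k i) trivial
  have hbot : ((isAffineOpen_top (Spec (CommRingCat.of k))).primeIdealOf
      ⟨closedPoint k, trivial⟩).asIdeal = ⊥ := by
    have hΓ : IsField Γ(Spec (CommRingCat.of k), ⊤) :=
      MulEquiv.isField (Field.toIsField k)
        (Scheme.ΓSpecIso (CommRingCat.of k)).commRingCatIsoToRingEquiv.toMulEquiv
    letI : Field Γ(Spec (CommRingCat.of k), ⊤) := hΓ.toField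
    exact Ideal.eq_bot_of_prime _
  have e1 : (isAffineOpen_basicOpen_X k i).primeIdealOf ⟨y k i, y_mem k i⟩ =
      PrimeSpectrum.comap ((ptHom k i).appLE (Proj.basicOpen (A k) (X i)) ⊤
        (top_le_preimage_ptHom k i)).hom
        ((isAffineOpen_top (Spec (CommRingCat.of k))).primeIdealOf ⟨closedPoint k, trivial⟩) :=
    key.symm
  rw [e1, PrimeSpectrum.comap_asIdeal, Ideal.mem_comap, hbot, Ideal.mem_bot, evalPt,
    RingHom.comp_apply]
  constructor
  · intro h; rw [h, map_zero]
  · intro h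
    exact (Scheme.ΓSpecIso (CommRingCat.of k)).commRingCatIsoToRingEquiv.injective
      (h.trans (map_zero _).symm)

/-- The prime ideal of `yᵢ` in `D₊(xᵢ)` is the kernel of `evalPt`. [folklore] -/
theorem primeIdealOf_y_eq_ker (i : Fin 2) :
    ((isAffineOpen_basicOpen_X k i).primeIdealOf ⟨y k i, y_mem k i⟩).asIdeal =
      RingHom.ker (evalPt k i) :=
  Ideal.ext fun s => (mem_primeIdealOf_y_iff k i s).trans (RingHom.mem_ker).symm

/-- The prime ideal of `yᵢ` in `D₊(xᵢ)` is maximal (`yᵢ` is a rational, closed point). [folklore] -/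
theorem isMaximal_primeIdealOf_y (i : Fin 2) :
    ((isAffineOpen_basicOpen_X k i).primeIdealOf ⟨y k i, y_mem k i⟩).asIdeal.IsMaximal := by
  rw [primeIdealOf_y_eq_ker]
  exact RingHom.ker_isMaximal_of_surjective _ (evalPt_surjective k i)

/-- **The prime ideal of `ptᵢ` in the chart `D₊(xᵢ)` is generated by `x_j/x_i`.** [folklore] -/
theorem primeIdealOf_y (i : Fin 2) :
    ((isAffineOpen_basicOpen_X k i).primeIdealOf ⟨y k i, y_mem k i⟩).asIdeal =
      Ideal.span {sec k i} := by
  ext s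
  rw [mem_primeIdealOf_y_iff]
  constructor
  · intro hs
    obtain ⟨b, rfl⟩ := awayToSection_surjective k i s
    rw [evalPt_awayToSection] at hs
    have hb' := mem_span_e_of_ev_eq_zero k i hs
    rw [Ideal.mem_span_singleton] at hb' ⊢
    obtain ⟨q, rfl⟩ := hb'
    refine ⟨Proj.awayToSection (A k) (X i) q, ?_⟩
    rw [map_mul]
    rfl
  · intro hs
    rw [Ideal.mem_span_singleton] at hs
    obtain ⟨q, rfl⟩ := hs
    rw [map_mul, evalPt_sec, zero_mul]

/-! ### Uniformisers at `0` and `∞` -/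

/-- **`x_j/x_i` is a uniformiser at `ptᵢ`**: the maximal ideal of `𝒪_{ℙ¹, yᵢ}` is generated by the
germ of the section `x_j/x_i` (the stalk is the localisation of `Γ(ℙ¹, D₊(xᵢ)) ≅ k[T]` at the
prime `(T)` of `yᵢ`). [folklore] -/
theorem maximalIdeal_stalk_y (i : Fin 2) :
    maximalIdeal ((P k).presheaf.stalk (y k i)) =
      Ideal.span {(P k).presheaf.germ (Proj.basicOpen (A k) (X i)) (y k i) (y_mem k i) (sec k i)} := by
  have hU := isAffineOpen_basicOpen_X k i
  letI : Algebra Γ(P k, Proj.basicOpen (A k) (X i)) ((P k).presheaf.stalk (y k i)) :=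
    TopCat.Presheaf.algebra_section_stalk (P k).presheaf
      (⟨y k i, y_mem k i⟩ : Proj.basicOpen (A k) (X i))
  haveI : IsLocalization.AtPrime ((P k).presheaf.stalk (y k i))
      (hU.primeIdealOf ⟨y k i, y_mem k i⟩).asIdeal :=
    hU.isLocalization_stalk ⟨y k i, y_mem k i⟩
  rw [← IsLocalization.AtPrime.map_eq_maximalIdeal (hU.primeIdealOf ⟨y k i, y_mem k i⟩).asIdeal
    ((P k).presheaf.stalk (y k i)), primeIdealOf_y, Ideal.map_span, Set.image_singleton]
  rfl

/-- The germ of `x_j/x_i` at `yᵢ` maps to `τᵢ` in `K(ℙ¹)`. [folklore] -/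
theorem algebraMap_germ_sec (i : Fin 2) :
    algebraMap ((P k).presheaf.stalk (y k i)) (P k).functionField
      ((P k).presheaf.germ (Proj.basicOpen (A k) (X i)) (y k i) (y_mem k i) (sec k i)) = τ k i := by
  rw [Scheme.algebraMap_germ_eq_germToFunctionField]
  rfl

/-- **Uniformisers at `0` and `∞` (Fulton, Example 1.5.1 for `ℙ¹`)**: at every point `z = yᵢ`
(stated for all `z` equal to `yᵢ`, to be usable at points only propositionally equal to it) the
maximal ideal of `𝒪_{ℙ¹, z}` is generated by an element whose image in `K(ℙ¹)` is `τᵢ`, i.e. `t`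
at `0 = (1 : 0)` and `t⁻¹` at `∞ = (0 : 1)`. [cite: Fulton1998, Example 1.5.1] -/
theorem exists_uniformiser (i : Fin 2) (z : P k) (hz : z = y k i) :
    ∃ π : (P k).presheaf.stalk z, maximalIdeal _ = Ideal.span {π} ∧
      algebraMap _ (P k).functionField π = τ k i := by
  subst hz
  exact ⟨_, maximalIdeal_stalk_y k i, algebraMap_germ_sec k i⟩

/-! ### `t` is a unit away from `0` and `∞` -/

/-- The charts `D₊(x₀)`, `D₊(x₁)` cover `ℙ¹`. [folklore] -/
theorem exists_mem_basicOpen_X (z : P k) : ∃ i : Fin 2, z ∈ Proj.basicOpen (A k) (X i) := by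
  have hle : (HomogeneousIdeal.irrelevant (A k)).toIdeal ≤
      Ideal.span (Set.range (X : Fin 2 → MvPolynomial (Fin 2) k)) :=
    ProjectiveSpace.irrelevant_le_span 1 k
  have h := Proj.iSup_basicOpen_eq_top (A k) (X : Fin 2 → MvPolynomial (Fin 2) k) hle
  have hz : z ∈ (⨆ i, Proj.basicOpen (A k) (X i : MvPolynomial (Fin 2) k)) := by
    rw [h]; trivial
  exact Opens.mem_iSup.mp hz

/-- In the chart `D₊(xᵢ)`, a point other than `yᵢ` carries a unit germ of `x_j/x_i`. [folklore] -/
theorem isUnit_germ_sec_of_ne (i : Fin 2) {z : P k} (hz : z ∈ Proj.basicOpen (A k) (X i))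
    (hne : z ≠ y k i) :
    IsUnit ((P k).presheaf.germ (Proj.basicOpen (A k) (X i)) z hz (sec k i)) := by
  have hU := isAffineOpen_basicOpen_X k i
  letI : Algebra Γ(P k, Proj.basicOpen (A k) (X i)) ((P k).presheaf.stalk z) :=
    TopCat.Presheaf.algebra_section_stalk (P k).presheaf (⟨z, hz⟩ : Proj.basicOpen (A k) (X i))
  haveI : IsLocalization.AtPrime ((P k).presheaf.stalk z) (hU.primeIdealOf ⟨z, hz⟩).asIdeal :=
    hU.isLocalization_stalk ⟨z, hz⟩
  have key := IsLocalization.AtPrime.isUnit_to_map_iff ((P k).presheaf.stalk z)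
    (hU.primeIdealOf ⟨z, hz⟩).asIdeal (sec k i)
  change IsUnit (algebraMap _ ((P k).presheaf.stalk z) (sec k i))
  rw [key]
  intro hmem
  apply hne
  -- `(x_j/x_i) = 𝔭_{yᵢ}` is maximal and contained in `𝔭_z`, so the two primes (and points) agree
  have hle : (hU.primeIdealOf ⟨y k i, y_mem k i⟩).asIdeal ≤ (hU.primeIdealOf ⟨z, hz⟩).asIdeal := by
    rw [primeIdealOf_y, Ideal.span_le, Set.singleton_subset_iff]
    exact hmem
  have heq : hU.primeIdealOf ⟨y k i, y_mem k i⟩ = hU.primeIdealOf ⟨z, hz⟩ :=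
    PrimeSpectrum.ext ((isMaximal_primeIdealOf_y k i).eq_of_le
      (hU.primeIdealOf ⟨z, hz⟩).isPrime.ne_top hle)
  have h1 := hU.fromSpec_primeIdealOf ⟨z, hz⟩
  have h2 := hU.fromSpec_primeIdealOf ⟨y k i, y_mem k i⟩
  rw [heq] at h2
  exact h1.symm.trans h2

/-- **`t` is a unit away from `0` and `∞`**: at every point of `ℙ¹` other than `y₀ = (1 : 0)` and
`y₁ = (0 : 1)`, the coordinate `t = x₁/x₀` is the image in `K(ℙ¹)` of a unit of the local ring.
[cite: Fulton1998, Example 1.5.1] -/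
theorem exists_isUnit_of_ne {z : P k} (h0 : z ≠ y k 0) (h1 : z ≠ y k 1) :
    ∃ u : (P k).presheaf.stalk z, IsUnit u ∧ algebraMap _ (P k).functionField u = t k := by
  obtain ⟨i, hz⟩ := exists_mem_basicOpen_X k z
  have hne : z ≠ y k i := by
    fin_cases i
    · exact h0
    · exact h1
  have hu := isUnit_germ_sec_of_ne k i hz hne
  have hval : algebraMap ((P k).presheaf.stalk z) (P k).functionField
      ((P k).presheaf.germ (Proj.basicOpen (A k) (X i)) z hz (sec k i)) = τ k i := by
    rw [Scheme.algebraMap_germ_eq_germToFunctionField]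
    rfl
  fin_cases i
  · exact ⟨_, hu, hval⟩
  · obtain ⟨v, hv⟩ := hu.exists_right_inv
    refine ⟨v, IsUnit.of_mul_eq_one_right _ hv, ?_⟩
    have h := congrArg (algebraMap ((P k).presheaf.stalk z) (P k).functionField) hv
    rw [map_mul, map_one, hval] at h
    change τ k 1 * _ = 1 at h
    rw [τ_one] at h
    exact ((inv_mul_eq_one₀ (t_ne_zero k)).mp h).symm

/-- **`0 ≠ ∞` on `ℙ¹`.** [folklore] -/
theorem y_zero_ne_y_one : y k 0 ≠ y k 1 := by
  intro h
  obtain ⟨π₁, hm₁, hπ₁⟩ := exists_uniformiser k 1 (y k 0) h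
  have hm₀ := maximalIdeal_stalk_y k 0
  have hπ₀ := algebraMap_germ_sec k 0
  set π₀ := (P k).presheaf.germ (Proj.basicOpen (A k) (X 0)) (y k 0) (y_mem k 0) (sec k 0)
  have hprod : algebraMap ((P k).presheaf.stalk (y k 0)) (P k).functionField (π₀ * π₁) = 1 := by
    rw [map_mul, hπ₀, hπ₁, τ_zero, τ_one, mul_inv_cancel₀ (t_ne_zero k)]
  have hone : π₀ * π₁ = 1 :=
    IsFractionRing.injective ((P k).presheaf.stalk (y k 0)) (P k).functionField
      (hprod.trans (map_one _).symm)
  have hunit : IsUnit π₀ := IsUnit.of_mul_eq_one _ hone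
  have hmem : π₀ ∈ maximalIdeal ((P k).presheaf.stalk (y k 0)) := by
    rw [hm₀]; exact Ideal.mem_span_singleton_self _
  exact (IsLocalRing.mem_maximalIdeal _).mp hmem hunit

/-! ### `ℙ¹ → Spec k` is a smooth proper integral curve -/

/-- `ℙ¹ → Spec k` is smooth of relative dimension `1` (chart by chart,
`ProjectiveSpace.smoothOfRelativeDimension_projToSpec`). [folklore] -/
theorem smoothOfRelativeDimension_one_toSpec :
    SmoothOfRelativeDimension 1 (Segre.toSpec (Fin 2) k) :=
  ProjectiveSpace.smoothOfRelativeDimension_projToSpec 1 k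

/-- `ℙ¹ → Spec k` is proper. [folklore] -/
theorem isProper_toSpec : IsProper (Segre.toSpec (Fin 2) k) :=
  ProjBaseChangeRing.isProper_projToSpec (Fin 2) k

end Literature.AlgebraicGeometry.Motives.ProjLine

end
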